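import Mathlib
import Summits.Ventures.DiscreteObjects.Mahler.SubLehmerDegreeTwelve
import Summits.Ventures.DiscreteObjects.Mahler.CensusKernelDeg12T
import Literature.NumberTheory.MahlerMeasure.MinimalMeasuresByDegree

/-!
# Mossinghoff–Rhin–Wu's "minimal Mahler measure by degree" for `D ≤ 12`, in the kernel (venture `DiscreteObjects`, target L)

Cell `pub-namedobj`, seat `pub-namedobj-mahler-g12`. Framing: lottery ticket; floor = certified bounds/negative
ranges.

The Literature named fact `MinimalMeasureByDegree` [cite: MossinghoffRhinWu2008, Theorem 1.1 p.452, Table 1 p.453] asserts, for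
every even `8 ≤ D ≤ 54`, that an irreducible noncyclotomic primitive integer polynomial of degree `D` has Mahler measure
`≥ M(mrwMinimalPoly D)`. Here its instances `D = 8, 10, 12` are PROVED (`minimalMeasureByDegree_le_twelve`; see also `SubLehmerDegreeFourteen.minimalMeasure_degree_twelve`), in the Literature
file's exact wording (the primitivity hypothesis is not even needed), from the kernel census rows `degreeCensus_eight / ten /
twelve` and the kernel enclosures of the listed measures (gens 10–11). The remaining instances `14 ≤ D ≤ 54` stay a cited
computation.
-/

namespace Summit.Ventures.DiscreteObjects.Mahler

open Polynomial Literature.NumberTheory.MahlerMeasure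

/-- **`MinimalMeasureByDegree` for `D ≤ 12` (proved):** for every even `8 ≤ D ≤ 12`, an irreducible integer polynomial
of degree `D` with `M > 1` (primitive or not) has `M ≥ M(mrwMinimalPoly D)` — the `D = 8, 10, 12` rows of MRW's Theorem 1.1 /
Table 1 in the Literature file's own terms. -/
theorem minimalMeasureByDegree_le_twelve :
    ∀ D : ℕ, Even D → 8 ≤ D → D ≤ 12 →
      ∀ P : ℤ[X], Irreducible P → P.natDegree = D → 1 < (P.map (Int.castRingHom ℂ)).mahlerMeasure →
        (∀ k : ℕ, 2 ≤ k → ∀ Q : ℤ[X], P ≠ expand ℤ k Q) →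
          ((mrwMinimalPoly D).map (Int.castRingHom ℂ)).mahlerMeasure ≤ (P.map (Int.castRingHom ℂ)).mahlerMeasure := by
  intro D hD h8 h12 P hirr hdeg h1 _
  change 1 < intMahlerMeasure P at h1
  change intMahlerMeasure (mrwMinimalPoly D) ≤ intMahlerMeasure P
  obtain ⟨k, rfl⟩ := hD
  rcases (by omega : k = 4 ∨ k = 5 ∨ k = 6) with rfl | rfl | rfl
  · have h := minimalMeasure_degree_eight hirr hdeg h1
    have e : mrwMinimalPoly (4 + 4) = mrwPoly8 := rfl
    rw [e]; exact h
  · have h := minimalMeasure_degree_ten hirr hdeg h1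
    have e : intMahlerMeasure (mrwMinimalPoly (5 + 5)) = intMahlerMeasure lehmerPoly := by
      rw [show (5 + 5 : ℕ) = 10 from rfl]
      show intMahlerMeasure lehmerPolynomial = intMahlerMeasure lehmerPoly
      rw [← intMahlerMeasure_comp_neg_X lehmerPoly, ← ofCoeffs_c10_01_eq]
      exact (coresDeg10_min c10_01 (by simp [coresDeg10])).antisymm
        (le_of_eq (by rw [ofCoeffs_c10_01_eq, intMahlerMeasure_comp_neg_X]; rfl))
    rw [e]; exact h
  · -- degree 12, from the kernel census row and the enclosures of the five listed measures
    by_cases h : intMahlerMeasure P < 13 / 10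
    · obtain ⟨l, hl, hform⟩ := degreeCensus_twelve P hdeg hirr h1 h
      rw [intMahlerMeasure_of_census_form hform]
      exact coresDeg12_min l hl
    · push Not at h
      have h12 : intMahlerMeasure (mrwMinimalPoly 12) ≤ intMahlerMeasure (ofCoeffs c12_01) :=
        coresDeg12_min c12_01 (by simp [coresDeg12])
      exact le_trans h12 (le_trans (le_of_lt (coresDeg12_measure_bounds c12_01 (by simp [coresDeg12])).2) h)

end Summit.Ventures.DiscreteObjects.Mahler
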